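import Summits.ResolutionOfSingularities.ResolutionOfSingularities.Theorems.FrobeniusLadderFRationalResolutionBlowupRegularFlatChart
import Summits.ResolutionOfSingularities.ResolutionOfSingularities.Theorems.FrobeniusLadderFRationalResolutionDescendedPrimaryPieceCover
import Summits.ResolutionOfSingularities.ResolutionOfSingularities.Theorems.FrobeniusLadderFRationalResolutionBlowupSmoothAscent
import HarnessLib

/-!
# Crux `FrobeniusLadder.FRationalResolution` (stmt-ResolutionOfSingularities-15317), line `redirect`,
# stub `stub_diagonalizableQuotientResolution` — the hypothesis `hreg : ∃ g ∉ 𝔔', Bl_{I B'_g} regular` of the one-point obligation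
# from ONE flat chart at `𝔔'`, from the local ring `B'_{𝔔'}`, or from its adic completion `Ê`

`…GaloisBaseChangeRegular.hloc_of_decomposition_stable_piece'` (and `…BlowupOrbitCentre`, `…BlowupComaximalCentres.isRegular_affineBlowup_iInf`)
consume the regularity of the blow-up of a `𝔔'`-primary piece in the NEIGHBOURHOOD form `∃ g ∉ 𝔔', Bl_{I B'_g}(Spec B'_g)` regular.
`…BlowupRegularFlatChart` (this generation) detects regularity of `Bl_I(Spec B)` on one flat chart at the point when `Spec B ∖ {𝔮}`
is regular; here the same is done RELATIVE TO A BASIC OPEN `D(g) ∋ 𝔮` on which the other singular points have been discarded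
(`B' = B ⊗_K K'` is singular exactly at the finitely many primes over `𝔭`):

* `isRegular_affineBlowup_of_flat_ringHom` — ring-hom form of `…BlowupRegularFlatChart.isRegular_affineBlowup_of_flat_chart`;
* **`isRegular_affineBlowup_away_of_flat_chart`** — `B`, `C` Noetherian, `C` flat over `B` with a prime `𝔚` over the maximal `𝔮`,
  `𝔮ⁿ ⊆ I ⊆ 𝔮`, `g ∉ 𝔮` with `D(g) ∖ {𝔮}` regular: `Bl_{IC}(Spec C)` regular ⇒ `Bl_{I B_g}(Spec B_g)` regular (localize the chart:
  `B_g → C_g` is flat — `…FlatCoverLocalization.flat_awayMap` —, `𝔚 C_g` lies over `𝔮 B_g`, and `Bl_{I C_g}` is regular by smooth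
  ascent along `Spec C_g → Spec C`, `…BlowupSmoothAscent`);
* `isRegular_affineBlowup_away_of_atPrime` — `C = B_𝔮`;
* **`isRegular_affineBlowup_away_of_adicCompletion_atPrime`** — `C = (B_𝔮)^`: `Bl_{I Ê}(Spec Ê)` regular ⇒ `Bl_{I B_g}(Spec B_g)` regular,
  i.e. the `hreg` input of the Galois route read in the complete local ring (MEMO-15317-leafhand2-g15 §3 (S2), completion step).

Honest label: generic scheme plumbing toward ONE leaf stub (no stub, crux or summit closed). No definitions, no named facts, no
sorry. [cite: GortzWedhorn2020, Prop. 13.91 (2)] [cite: Matsumura1987, Thm. 23.7 (i); Thm. 8.14] [cite: StacksProject, Tag 02NS]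
-/

noncomputable section

-- single-problem summit: the doubled namespace component is forced
set_option linter.dupNamespace false

open CategoryTheory CategoryTheory.Limits AlgebraicGeometry
open Literature.AlgebraicGeometry.Resolution
open Summit.ResolutionOfSingularities.ResolutionOfSingularities.Theorems.FRationalResolution

namespace Summit.ResolutionOfSingularities.ResolutionOfSingularities.Theorems.FRationalResolution.BlowupRegularFlatChartAway

/-- Ring-hom form of `…BlowupRegularFlatChart.isRegular_affineBlowup_of_flat_chart`: `φ : B → C` flat with a prime `𝔚` over the
maximal `𝔮`, `𝔮ⁿ ⊆ I ⊆ 𝔮`, `Spec B ∖ {𝔮}` regular, `Bl_{Iφ}(Spec C)` regular ⇒ `Bl_I(Spec B)` regular.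
[cite: GortzWedhorn2020, Prop. 13.91 (2)] [cite: Matsumura1987, Thm. 23.7 (i)] -/
theorem isRegular_affineBlowup_of_flat_ringHom {B C : Type} [CommRing B] [CommRing C] [IsNoetherianRing B]
    (φ : B →+* C) (hφ : φ.Flat) (𝔮 : Ideal B) [𝔮.IsMaximal] (I : Ideal B) {n : ℕ} (hI : 𝔮 ^ n ≤ I)
    (hI𝔮 : I ≤ 𝔮) (hoff : ∀ x : Spec (.of B), x.asIdeal ≠ 𝔮 → x ∈ Scheme.regularLocus (Spec (.of B)))
    (𝔚 : Ideal C) [𝔚.IsPrime] (h𝔚𝔮 : 𝔚.comap φ = 𝔮) (h : Scheme.IsRegular (affineBlowup (I.map φ))) :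
    Scheme.IsRegular (affineBlowup I) := by
  letI : Algebra B C := φ.toAlgebra
  haveI : Module.Flat B C := hφ
  exact BlowupRegularFlatChart.isRegular_affineBlowup_of_flat_chart 𝔮 I hI hI𝔮 hoff 𝔚 h𝔚𝔮 h

/-- **`hreg` in neighbourhood form from ONE flat chart at the point.** `B`, `C` Noetherian, `C` a flat `B`-algebra with a prime `𝔚`
over the maximal ideal `𝔮`, `𝔮ⁿ ⊆ I ⊆ 𝔮`, `g ∉ 𝔮` such that every prime `x ≠ 𝔮` with `g ∉ x` is a regular point of `Spec B`.
If `Bl_{IC}(Spec C)` is regular, then `Bl_{I B_g}(Spec B_g)` is regular. [cite: GortzWedhorn2020, Prop. 13.91 (2)]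
[cite: Matsumura1987, Thm. 23.7 (i)] [cite: StacksProject, Tag 02NS] -/
theorem isRegular_affineBlowup_away_of_flat_chart {B C : Type} [CommRing B] [CommRing C] [IsNoetherianRing B]
    [IsNoetherianRing C] [Algebra B C] [Module.Flat B C] (𝔮 : Ideal B) [h𝔮 : 𝔮.IsMaximal] (I : Ideal B) {n : ℕ}
    (hI : 𝔮 ^ n ≤ I) (hI𝔮 : I ≤ 𝔮) {g : B} (hg : g ∉ 𝔮)
    (hoff : ∀ x : Spec (.of B), x.asIdeal ≠ 𝔮 → g ∉ x.asIdeal → x ∈ Scheme.regularLocus (Spec (.of B)))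
    (𝔚 : Ideal C) [h𝔚 : 𝔚.IsPrime] (h𝔚𝔮 : 𝔚.comap (algebraMap B C) = 𝔮)
    (h : Scheme.IsRegular (affineBlowup (I.map (algebraMap B C)))) :
    Scheme.IsRegular (affineBlowup (I.map (algebraMap B (Localization.Away g)))) := by
  -- the localized chart `φ : B_g → C_g`
  obtain ⟨L, hL⟩ : ∃ L : Type, L = Localization.Away g := ⟨_, rfl⟩
  subst hL
  obtain ⟨CL, hCL⟩ : ∃ CL : Type, CL = Localization.Away (algebraMap B C g) := ⟨_, rfl⟩
  subst hCL
  set φ : Localization.Away g →+* Localization.Away (algebraMap B C g) :=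
    IsLocalization.Away.map (Localization.Away g) (Localization.Away (algebraMap B C g)) (algebraMap B C) g with hφ
  have hφflat : φ.Flat :=
    FlatCoverLocalization.flat_awayMap B C (RingHom.flat_algebraMap_iff.mpr inferInstance) g _ _
  haveI : IsNoetherianRing (Localization.Away g) :=
    IsLocalization.isNoetherianRing (Submonoid.powers g) (Localization.Away g) inferInstance
  -- the maximal ideal `𝔮 B_g` and the coprimary centre `I B_g`
  haveI h𝔮L : (𝔮.map (algebraMap B (Localization.Away g))).IsMaximal :=
    BlowupSmoothAscent.isMaximal_map_away 𝔮 hg (Localization.Away g)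
  have hIL : 𝔮.map (algebraMap B (Localization.Away g)) ^ n ≤ I.map (algebraMap B (Localization.Away g)) := by
    rw [← Ideal.map_pow]
    exact Ideal.map_mono hI
  have hI𝔮L : I.map (algebraMap B (Localization.Away g)) ≤ 𝔮.map (algebraMap B (Localization.Away g)) :=
    Ideal.map_mono hI𝔮
  -- `Spec B_g ∖ {𝔮 B_g}` is regular
  have hoffL : ∀ x : Spec (.of (Localization.Away g)), x.asIdeal ≠ 𝔮.map (algebraMap B (Localization.Away g)) →
      x ∈ Scheme.regularLocus (Spec (.of (Localization.Away g))) := by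
    intro x hx
    rw [FlatCoverLocalization.mem_regularLocus_away_iff g (Localization.Away g) x]
    refine hoff _ (fun hx𝔮 => hx ?_) (fun hgx => ?_)
    · -- `x ∩ B = 𝔮 ⇒ x = 𝔮 B_g`
      have hx' : (x.asIdeal.comap (algebraMap B (Localization.Away g))).map
          (algebraMap B (Localization.Away g)) = x.asIdeal :=
        IsLocalization.map_under (Submonoid.powers g) (Localization.Away g) x.asIdeal
      rw [← hx']
      exact congrArg _ hx𝔮
    · -- `g ∉ x ∩ B` since `g` is a unit in `B_g`
      exact x.2.ne_top (Ideal.eq_top_of_isUnit_mem _ hgx (IsLocalization.Away.algebraMap_isUnit g))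
  -- the prime `𝔚 C_g` of the localized chart lies over `𝔮 B_g`
  have hg𝔚 : algebraMap B C g ∉ 𝔚 := by
    intro hmem
    exact hg (h𝔚𝔮 ▸ (Ideal.mem_comap.mpr hmem))
  have hdisj : Disjoint ((Submonoid.powers (algebraMap B C g) : Submonoid C) : Set C) (𝔚 : Set C) := by
    refine Set.disjoint_left.mpr ?_
    rintro x ⟨m, rfl⟩ hx
    exact hg𝔚 (h𝔚.mem_of_pow_mem m hx)
  haveI h𝔚L : (𝔚.map (algebraMap C (Localization.Away (algebraMap B C g)))).IsPrime :=
    IsLocalization.isPrime_of_isPrime_disjoint (Submonoid.powers (algebraMap B C g)) _ 𝔚 h𝔚 hdisj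
  have e1 : (𝔚.map (algebraMap C (Localization.Away (algebraMap B C g)))).comap
      (algebraMap C (Localization.Away (algebraMap B C g))) = 𝔚 :=
    IsLocalization.under_map_of_isPrime_disjoint (Submonoid.powers (algebraMap B C g)) _ h𝔚 hdisj
  have hcomapB : ((𝔚.map (algebraMap C (Localization.Away (algebraMap B C g)))).comap φ).comap
      (algebraMap B (Localization.Away g)) = 𝔮 := by
    rw [Ideal.comap_comap, hφ, DescendedPrimaryPieceCover.awayMap_comp_algebraMap, ← Ideal.comap_comap, e1, h𝔚𝔮]
  have e2 : (((𝔚.map (algebraMap C (Localization.Away (algebraMap B C g)))).comap φ).comap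
      (algebraMap B (Localization.Away g))).map (algebraMap B (Localization.Away g)) =
      (𝔚.map (algebraMap C (Localization.Away (algebraMap B C g)))).comap φ :=
    IsLocalization.map_under (Submonoid.powers g) (Localization.Away g) _
  have h𝔚𝔮L : (𝔚.map (algebraMap C (Localization.Away (algebraMap B C g)))).comap φ =
      𝔮.map (algebraMap B (Localization.Away g)) := by
    rw [← e2, hcomapB]
  -- `Bl_{I C_g}(Spec C_g)` is regular: smooth (open) ascent from `Bl_{IC}(Spec C)`
  haveI : IsOpenImmersion (Spec.map (CommRingCat.ofHom (algebraMap C (Localization.Away (algebraMap B C g))))) :=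
    IsOpenImmersion.of_isLocalization (algebraMap B C g)
  have hup : Scheme.IsRegular (affineBlowup ((I.map (algebraMap B (Localization.Away g))).map φ)) := by
    rw [hφ, DescendedPrimaryPieceCover.map_awayMap_eq g (Localization.Away g) (Localization.Away (algebraMap B C g)) I
      (I.map (algebraMap B C)) rfl]
    exact BlowupSmoothAscent.isRegular_affineBlowup_map_of_smooth _ (I.map (algebraMap B C)) h
  exact isRegular_affineBlowup_of_flat_ringHom φ hφflat _ _ hIL hI𝔮L hoffL _ h𝔚𝔮L hup

/-- **`hreg` in neighbourhood form from the local ring**: `B` Noetherian, `𝔮` maximal, `𝔮ⁿ ⊆ I ⊆ 𝔮`, `g ∉ 𝔮` with `D(g) ∖ {𝔮}`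
regular; `Bl_{I B_𝔮}(Spec B_𝔮)` regular ⇒ `Bl_{I B_g}(Spec B_g)` regular. [cite: GortzWedhorn2020, Prop. 13.91 (2)]
[cite: Matsumura1987, Thm. 23.7 (i)] -/
theorem isRegular_affineBlowup_away_of_atPrime {B : Type} [CommRing B] [IsNoetherianRing B] (𝔮 : Ideal B)
    [h𝔮 : 𝔮.IsMaximal] (I : Ideal B) {n : ℕ} (hI : 𝔮 ^ n ≤ I) (hI𝔮 : I ≤ 𝔮) {g : B} (hg : g ∉ 𝔮)
    (hoff : ∀ x : Spec (.of B), x.asIdeal ≠ 𝔮 → g ∉ x.asIdeal → x ∈ Scheme.regularLocus (Spec (.of B)))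
    (h : Scheme.IsRegular (affineBlowup (I.map (algebraMap B (Localization.AtPrime 𝔮))))) :
    Scheme.IsRegular (affineBlowup (I.map (algebraMap B (Localization.Away g)))) := by
  haveI : Module.Flat B (Localization.AtPrime 𝔮) := IsLocalization.flat _ 𝔮.primeCompl
  haveI : IsNoetherianRing (Localization.AtPrime 𝔮) :=
    IsLocalization.isNoetherianRing 𝔮.primeCompl (Localization.AtPrime 𝔮) inferInstance
  exact isRegular_affineBlowup_away_of_flat_chart 𝔮 I hI hI𝔮 hg hoff
    (IsLocalRing.maximalIdeal (Localization.AtPrime 𝔮)) (Localization.AtPrime.under_maximalIdeal (I := 𝔮)) h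

/-- **THE COMPLETION STEP for `hreg`, neighbourhood form.** `B` Noetherian, `𝔮` maximal, `𝔮ⁿ ⊆ I ⊆ 𝔮`, `g ∉ 𝔮` with
`D(g) ∖ {𝔮}` regular, `Ê = (B_𝔮)^`: if `Bl_{I Ê}(Spec Ê)` is regular then `Bl_{I B_g}(Spec B_g)` is regular — exactly the input
`hreg` of `…GaloisBaseChangeRegular.hloc_of_decomposition_stable_piece'`, read in the complete local ring.
[cite: Matsumura1987, Thm. 8.14; Thm. 23.7 (i)] [cite: GortzWedhorn2020, Prop. 13.91 (2)] [cite: StacksProject, Tag 02NS] -/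
theorem isRegular_affineBlowup_away_of_adicCompletion_atPrime {B : Type} [CommRing B] [IsNoetherianRing B] (𝔮 : Ideal B)
    [h𝔮 : 𝔮.IsMaximal] (I : Ideal B) {n : ℕ} (hI : 𝔮 ^ n ≤ I) (hI𝔮 : I ≤ 𝔮) {g : B} (hg : g ∉ 𝔮)
    (hoff : ∀ x : Spec (.of B), x.asIdeal ≠ 𝔮 → g ∉ x.asIdeal → x ∈ Scheme.regularLocus (Spec (.of B)))
    (h : Scheme.IsRegular (affineBlowup ((I.map (algebraMap B (Localization.AtPrime 𝔮))).map
      (algebraMap (Localization.AtPrime 𝔮)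
        (AdicCompletion (IsLocalRing.maximalIdeal (Localization.AtPrime 𝔮)) (Localization.AtPrime 𝔮)))))) :
    Scheme.IsRegular (affineBlowup (I.map (algebraMap B (Localization.Away g)))) := by
  haveI : IsNoetherianRing (Localization.AtPrime 𝔮) :=
    IsLocalization.isNoetherianRing 𝔮.primeCompl (Localization.AtPrime 𝔮) inferInstance
  exact isRegular_affineBlowup_away_of_atPrime 𝔮 I hI hI𝔮 hg hoff
    (BlowupRegularFlatChart.isRegular_affineBlowup_of_adicCompletion _ h)

end Summit.ResolutionOfSingularities.ResolutionOfSingularities.Theorems.FRationalResolution.BlowupRegularFlatChartAway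

end
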